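import Summits.CriticalPhenomena.PercolationContinuityZ3.Theorems.Transplant.FKThreeApexT2BernA
import Summits.CriticalPhenomena.PercolationContinuityZ3.Theorems.Transplant.FKThreeApexT2BernB
import Summits.CriticalPhenomena.PercolationContinuityZ3.Theorems.Transplant.FKThreeApexT2BernC
import Summits.CriticalPhenomena.PercolationContinuityZ3.Theorems.Transplant.FKThreeApexRigid
import HarnessLib

/-!
# Connectivity correlation inequalities for `φ_{w,q}`, `0 < q ≤ 1` — the three-apex monoid: the ADJACENT pair `(u₁ a, u₂ a)` (type T2), THEOREM

Helper file (`--supports stmt-CriticalPhenomena-4575`), FK sub-lane `prim-bschramm-fk-3` (gen 13); builds on p205010 (kernel theorem, internal audit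
signed; external expert review pending).  Pure real algebra, no sorries; standard axioms.  Layer 1c of the `K_{1,1,1,n}` programme (memo
`bschramm/prim-bschramm-fk-3/THREE-APEX.md` §4).  With the coefficient table `t2Form` (`…T2Coeffs`) and the Bernstein certificates (`…T2BernA/B/C`):
**`t2_decomp`** `(1−q)·D₂(Z) = (−c₀₁)·N^{(bc)}(Z) + R(Z)` (a `ring` identity with the coefficients as atoms), **`t2Form_nonneg`** (`D₂ ≥ 0` whenever
`Z ≥ 0` and `N^{(bc)}(Z) ≥ 0`: if `c₀₁ ≥ 0` every coefficient is non-negative, otherwise `q < 1` and the remainder `R` is coefficientwise non-negative),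
**`InK.t2Form_nonneg`** (on the three-apex monoid, by the MASTER inequality `InK.masterNbc_nonneg`), and the PINNED IDENTITY **`rayleigh_T2_eq`**: for two
leaf letters pinned on their `a`-edges in front of an arbitrary vector `R`, the Rayleigh difference of the four valuations is `t2Form q b c r s R` — the
algebraic content of "two edges of `K_{1,1,1,n}` (or `K_{3,n}`) at a common APEX are negatively correlated, every `n`, all weights".
[cite: Grimmett2006, §3.9 eq. (3.94) (pp. 63–64)] [folklore]
-/

noncomputable section

namespace Summit.CriticalPhenomena.PercolationContinuityZ3.Theorems

namespace FK

namespace ThreeApex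

open T2 in
/-- **T2 decomposition**: `(1−q)·D₂ = (−c₀₁)·N^{(bc)}(Z) + R` (coefficients as atoms). [folklore] -/
theorem t2_decomp (q b c r s : ℝ) (Z : V5) :
    (1 - q) * t2Form q b c r s Z = (-(c_ot q b c r s)) * (Z.zbc * (q * Z.z0 + Z.zab + Z.zac + Z.zbc + Z.z1) + (1 - q) * (Z.zab * Z.zac - Z.z0 * Z.z1)) +
    ((1 - q) * c_oo q b c r s * (Z.z0 ^ 2) +
     (1 - q) * c_oab q b c r s * (Z.z0 * Z.zab) +
     (1 - q) * c_oac q b c r s * (Z.z0 * Z.zac) +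
     ((1 - q) * c_obc q b c r s + q * c_ot q b c r s) * (Z.z0 * Z.zbc) +
     (1 - q) * c_abab q b c r s * (Z.zab ^ 2) +
     ((1 - q) * c_abac q b c r s + (1 - q) * c_ot q b c r s) * (Z.zab * Z.zac) +
     ((1 - q) * c_abbc q b c r s + 1 * c_ot q b c r s) * (Z.zab * Z.zbc) +
     (1 - q) * c_abt q b c r s * (Z.zab * Z.z1) +
     (1 - q) * c_acac q b c r s * (Z.zac ^ 2) +
     ((1 - q) * c_acbc q b c r s + 1 * c_ot q b c r s) * (Z.zac * Z.zbc) +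
     (1 - q) * c_act q b c r s * (Z.zac * Z.z1) +
     ((1 - q) * c_bcbc q b c r s + 1 * c_ot q b c r s) * (Z.zbc ^ 2) +
     ((1 - q) * c_bct q b c r s + 1 * c_ot q b c r s) * (Z.zbc * Z.z1)) := by
  unfold t2Form c_oac c_abt c_acac c_acbc c_act c_bct
  ring

open T2 in
/-- **T2 for non-negative vectors with `N^{(bc)} ≥ 0`**: `D₂(Z) ≥ 0` (`0 ≤ q ≤ 1`, `b, c, r, s ∈ [0,1]`). [folklore] -/
theorem t2Form_nonneg {q b c r s : ℝ} (hq0 : 0 ≤ q) (hq1 : q ≤ 1) (hb0 : 0 ≤ b) (hb1 : b ≤ 1) (hc0 : 0 ≤ c) (hc1 : c ≤ 1) (hr0 : 0 ≤ r) (hr1 : r ≤ 1) (hs0 : 0 ≤ s) (hs1 : s ≤ 1)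
    {Z : V5} (hZ : Z.Nonneg) (hN : 0 ≤ Z.zbc * (q * Z.z0 + Z.zab + Z.zac + Z.zbc + Z.z1) + (1 - q) * (Z.zab * Z.zac - Z.z0 * Z.z1)) :
    0 ≤ t2Form q b c r s Z := by
  obtain ⟨h0, h1, h2, h3, h4⟩ := hZ
  have hq' : (0 : ℝ) ≤ 1 - q := sub_nonneg.2 hq1
  have goo : 0 ≤ c_oo q b c r s := T2.p_oo_nonneg hq0 hq1 hb0 hb1 hc0 hc1 hr0 hr1 hs0 hs1
  have goab : 0 ≤ c_oab q b c r s := T2.p_oab_nonneg hq0 hq1 hb0 hb1 hc0 hc1 hr0 hr1 hs0 hs1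
  have goac : 0 ≤ c_oac q b c r s := by unfold T2.c_oac; exact T2.p_oab_nonneg hq0 hq1 hc0 hc1 hb0 hb1 hs0 hs1 hr0 hr1
  have gobc : 0 ≤ c_obc q b c r s := T2.p_obc_nonneg hq0 hq1 hb0 hb1 hc0 hc1 hr0 hr1 hs0 hs1
  have gabab : 0 ≤ c_abab q b c r s := T2.p_abab_nonneg hq0 hq1 hb0 hb1 hc0 hc1 hr0 hr1 hs0 hs1
  have gabac : 0 ≤ c_abac q b c r s := T2.p_abac_nonneg hq0 hq1 hb0 hb1 hc0 hc1 hr0 hr1 hs0 hs1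
  have gabbc : 0 ≤ c_abbc q b c r s := T2.p_abbc_nonneg hq0 hq1 hb0 hb1 hc0 hc1 hr0 hr1 hs0 hs1
  have gabt : 0 ≤ c_abt q b c r s := by unfold T2.c_abt; exact T2.p_abab_nonneg hq0 hq1 hb0 hb1 hc0 hc1 hr0 hr1 hs0 hs1
  have gacac : 0 ≤ c_acac q b c r s := by unfold T2.c_acac; exact T2.p_abab_nonneg hq0 hq1 hc0 hc1 hb0 hb1 hs0 hs1 hr0 hr1
  have gacbc : 0 ≤ c_acbc q b c r s := by unfold T2.c_acbc; exact T2.p_abbc_nonneg hq0 hq1 hc0 hc1 hb0 hb1 hs0 hs1 hr0 hr1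
  have gact : 0 ≤ c_act q b c r s := by unfold T2.c_act; exact T2.p_abab_nonneg hq0 hq1 hc0 hc1 hb0 hb1 hs0 hs1 hr0 hr1
  have gbcbc : 0 ≤ c_bcbc q b c r s := T2.p_bcbc_nonneg hq0 hq1 hb0 hb1 hc0 hc1 hr0 hr1 hs0 hs1
  have gbct : 0 ≤ c_bct q b c r s := by unfold T2.c_bct; exact T2.p_bcbc_nonneg hq0 hq1 hb0 hb1 hc0 hc1 hr0 hr1 hs0 hs1
  have robc : 0 ≤ (1 - q) * c_obc q b c r s + q * c_ot q b c r s := T2.r_obc_nonneg hq0 hq1 hb0 hb1 hc0 hc1 hr0 hr1 hs0 hs1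
  have rbcbc : 0 ≤ (1 - q) * c_bcbc q b c r s + 1 * c_ot q b c r s := T2.r_bcbc_nonneg hq0 hq1 hb0 hb1 hc0 hc1 hr0 hr1 hs0 hs1
  have rabbc : 0 ≤ (1 - q) * c_abbc q b c r s + 1 * c_ot q b c r s := T2.r_abbc_nonneg hq0 hq1 hb0 hb1 hc0 hc1 hr0 hr1 hs0 hs1
  have rabac : 0 ≤ (1 - q) * c_abac q b c r s + (1 - q) * c_ot q b c r s := T2.r_abac_nonneg hq0 hq1 hb0 hb1 hc0 hc1 hr0 hr1 hs0 hs1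
  have racbc : 0 ≤ (1 - q) * c_acbc q b c r s + 1 * c_ot q b c r s := by
    unfold T2.c_acbc; rw [← T2.c_ot_swap q b c r s]; exact T2.r_abbc_nonneg hq0 hq1 hc0 hc1 hb0 hb1 hs0 hs1 hr0 hr1
  have rbct : 0 ≤ (1 - q) * c_bct q b c r s + 1 * c_ot q b c r s := by unfold T2.c_bct; exact T2.r_bcbc_nonneg hq0 hq1 hb0 hb1 hc0 hc1 hr0 hr1 hs0 hs1
  by_cases hc : 0 ≤ c_ot q b c r s
  · unfold t2Form
    exact add_nonneg (add_nonneg (add_nonneg (add_nonneg (add_nonneg (add_nonneg (add_nonneg (add_nonneg (add_nonneg (add_nonneg (add_nonneg (add_nonneg (add_nonneg (mul_nonneg goo (pow_nonneg h0 2)) (mul_nonneg goab (mul_nonneg h0 h1))) (mul_nonneg goac (mul_nonneg h0 h2))) (mul_nonneg gobc (mul_nonneg h0 h3))) (mul_nonneg hc (mul_nonneg h0 h4))) (mul_nonneg gabab (pow_nonneg h1 2))) (mul_nonneg gabac (mul_nonneg h1 h2))) (mul_nonneg gabbc (mul_nonneg h1 h3))) (mul_nonneg gabt (mul_nonneg h1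 h4))) (mul_nonneg gacac (pow_nonneg h2 2))) (mul_nonneg gacbc (mul_nonneg h2 h3))) (mul_nonneg gact (mul_nonneg h2 h4))) (mul_nonneg gbcbc (pow_nonneg h3 2))) (mul_nonneg gbct (mul_nonneg h3 h4))
  · have hneg : 0 ≤ -(c_ot q b c r s) := by linarith
    have hlt : 0 < 1 - q := by
      rcases hq'.lt_or_eq with h | h
      · exact h
      · exfalso; apply hc
        rw [c_ot_eq, ← h, zero_mul]
    have key := t2_decomp q b c r s Z
    have hR : 0 ≤ (1 - q) * t2Form q b c r s Z := by
      rw [key]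
      exact add_nonneg (mul_nonneg hneg hN) (add_nonneg (add_nonneg (add_nonneg (add_nonneg (add_nonneg (add_nonneg (add_nonneg (add_nonneg (add_nonneg (add_nonneg (add_nonneg (add_nonneg (mul_nonneg (mul_nonneg hq' goo) (pow_nonneg h0 2)) (mul_nonneg (mul_nonneg hq' goab) (mul_nonneg h0 h1))) (mul_nonneg (mul_nonneg hq' goac) (mul_nonneg h0 h2))) (mul_nonneg robc (mul_nonneg h0 h3))) (mul_nonneg (mul_nonneg hq' gabab) (pow_nonneg h1 2))) (mul_nonneg rabac (mul_nonneg h1 h2))) (mul_nonneg rabbc (mul_nonneg h1 h3))) (mul_nonneg (mul_nonneg hq' gabt) (mul_nonneg h1 h4))) (mul_nonneg (mul_nonneg hq' gacac) (pow_nonneg h2 2))) (mul_nonneg racbc (mul_nonneg h2 h3))) (mul_nonneg (mul_nonneg hq' gact) (mul_nonneg h2 h4))) (mul_nonneg rbcbc (pow_nonneg h3 2))) (mul_nonneg rbct (mul_nonneg h3 h4)))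
    exact (mul_nonneg_iff_of_pos_left hlt).1 hR

/-- **T2 on the three-apex monoid**: for `Z ∈ InK q` the form is non-negative — after the measure bridge, two edges of `K_{1,1,1,n}` at a
common apex are negatively correlated for every `n` and all weights. [folklore] -/
theorem InK.t2Form_nonneg {q b c r s : ℝ} (hq0 : 0 ≤ q) (hq1 : q ≤ 1) (hb0 : 0 ≤ b) (hb1 : b ≤ 1) (hc0 : 0 ≤ c) (hc1 : c ≤ 1) (hr0 : 0 ≤ r) (hr1 : r ≤ 1) (hs0 : 0 ≤ s) (hs1 : s ≤ 1)
    {Z : V5} (h : InK q Z) : 0 ≤ t2Form q b c r s Z :=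
  ThreeApex.t2Form_nonneg hq0 hq1 hb0 hb1 hc0 hc1 hr0 hr1 hs0 hs1 (h.nonneg hq0) (h.masterNbc_nonneg hq0 hq1)

/-- **Type T2, pinned identity**: two leaf letters pinned on their `a`-edges (`leaf q σ b c`, `leaf q τ r s`) in front of `R`; the Rayleigh
difference of the four valuations is the T2 form. [folklore] -/
theorem rayleigh_T2_eq (q b c r s : ℝ) (R : V5) :
    val q (conv (leaf q 1 b c) (conv (leaf q 0 r s) R)) * val q (conv (leaf q 0 b c) (conv (leaf q 1 r s) R)) -
        val q (conv (leaf q 1 b c) (conv (leaf q 1 r s) R)) * val q (conv (leaf q 0 b c) (conv (leaf q 0 r s) R)) =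
      t2Form q b c r s R := by
  unfold t2Form T2.c_oac T2.c_abt T2.c_acac T2.c_acbc T2.c_act T2.c_bct
  simp only [val, conv, leaf, V5.total]
  unfold T2.c_oo T2.c_oab T2.c_obc T2.c_ot T2.c_abab T2.c_abac T2.c_abbc T2.c_bcbc
  ring

/-- T2 on the monoid: the pinned Rayleigh difference is `≥ 0`. [folklore] -/
theorem rayleigh_T2_nonneg {q b c r s : ℝ} (hq0 : 0 ≤ q) (hq1 : q ≤ 1) (hb0 : 0 ≤ b) (hb1 : b ≤ 1) (hc0 : 0 ≤ c) (hc1 : c ≤ 1) (hr0 : 0 ≤ r) (hr1 : r ≤ 1) (hs0 : 0 ≤ s) (hs1 : s ≤ 1)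
    {R : V5} (hR : InK q R) :
    0 ≤ val q (conv (leaf q 1 b c) (conv (leaf q 0 r s) R)) * val q (conv (leaf q 0 b c) (conv (leaf q 1 r s) R)) -
        val q (conv (leaf q 1 b c) (conv (leaf q 1 r s) R)) * val q (conv (leaf q 0 b c) (conv (leaf q 0 r s) R)) := by
  rw [rayleigh_T2_eq]; exact hR.t2Form_nonneg hq0 hq1 hb0 hb1 hc0 hc1 hr0 hr1 hs0 hs1

end ThreeApex

end FK

end Summit.CriticalPhenomena.PercolationContinuityZ3.Theorems
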